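import Summits.CriticalPhenomena.PercolationContinuityZ3.Theorems.FK.FKSubcriticalSharpness
import Summits.CriticalPhenomena.PercolationContinuityZ3.Theorems.FK.ThetaInterlacing
import Summits.CriticalPhenomena.PercolationContinuityZ3.Theorems.FK.ContinuityQOneBridge
import HarnessLib

/-!
# Corollaries of sharpness: the mean-field bound for the FREE percolation probability, the `q = 1` regression
# `p_c(ℤ²) = 1/2` by the random-cluster route, and Grimmett's Thm (6.20) hypothesis discharged

Claimed R42 (8)(c) in the cell INBOX at 2026-08-28T02:11:55Z by fkp-10a gen 352 (NEW CLAIM #2 of the gen), addressed to coordinator fk-4 g266 (seated 01:27Z 2026-08-28; R146 l.8252: row FO-10a-g352 = package g352-osss; its (κ) clause sends the FK instantiation to a new claim, R147); lineage row FO-10a-g352f (self-suggested), package g352-fkosss, label FS-J.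
Support file of the `fk-continuity` cell (lineage fkp-10a, `--supports stmt-CriticalPhenomena-4575`); builds on
p205010 (kernel theorem, internal audit signed; external expert review pending).  No definitions, no named facts,
no sorries; standard axioms.  Package `g352-fkosss` = THE FK INSTANTIATION of the OSSS inequality for monotonic measures
(row FO-10a-g352 `g352-osss`): Duminil-Copin–Raoufi–Tassion's Theorem 1.2 (sharpness of the random-cluster phase
transition on `ℤ^d`, `q ≥ 1`) and, on `ℤ²`, `p_c(q) = √q/(1+√q)`.  UNCONDITIONAL; nothing here touches FH / TP_FK / the
`_r3` binders of the cell.  Slot 10 of row FO-10a-g352f (label FS-J, the ONE (κ) addendum of R147, word l.8271).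

* `exists_pos_forall_thetaFree_ge_mul_sub` — for `d ≥ 2`, `q ≥ 1`, `p₁ ∈ (p_c(q), 1)`: `∃ c > 0, ∀ p ∈ (p_c(q), p₁],
  θ⁰(p,q) ≥ c (p − p_c(q))` (the wired bound of `FKSharpnessOSSS.lean` transferred through the interlacing
  `θ¹(p',q) ≤ θ⁰(p,q)` for `p' < p`, the lineage's `thetaWired_le_thetaFree_of_lt`);
* `rcCriticalProb_two_one` — `rcCriticalProb 2 1 = 1/2` (the case `q = 1` of `rcCriticalProb_two_eq`): with the lineage's
  `rcCriticalProb_one_eq_criticalProb` this is Kesten's `p_c(ℤ²) = 1/2` by the random-cluster / decision-tree route (the tree's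
  `kesten_criticalProb_Z2` is not restated);
* `wired_exp_decay_below_selfDual_pred` — the hypothesis `h630` of MR-C's `rcCriticalProb_le_of_wired_exp_decay_below_selfDual_pred`
  (Grimmett Thm (6.30)'s displayed conclusion: exponential decay of `φ¹_{p,q}(0 ↔ ∂Λ_n)` for `p < p_sd(q−1)`, `q ≥ 2`) holds, since
  `p_sd(q−1) ≤ p_sd(q) = p_c(q)`; so Thm (6.20)'s bound is now unconditional (and superseded by `rcCriticalProb_two_eq`).
The ISING translation of sharpness (Duminil-Copin–Raoufi–Tassion's Potts theorem at `q = 2` in two-point form: exponential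
decay of `⟨σ_0σ_x⟩^∅_β` for every `β < β_c(d)`, Aizenman–Barsky–Fernández 1987) is ALREADY the tree's
`Literature.Probability.LatticeModels.twoPoint_exponentialDecay_of_lt_criticalBeta_holds` (`SharpnessDecayProofs.lean`,
by Duminil-Copin–Tassion's 2016 random-current route) — cited, not restated here.
No definitions.

## References
* H. Duminil-Copin, A. Raoufi, V. Tassion, Ann. of Math. 189 (2019) 75–99, Thm 1.2 (2), Thm 1.3. [DuminilCopinRaoufiTassion2019]
* G. Grimmett, *The Random-Cluster Model*, Springer 2006, Thm (5.16) (interlacing θ⁰/θ¹), Thm (6.20), Thm (6.30). [Grimmett2006]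
-/

noncomputable section

namespace Summit.CriticalPhenomena.PercolationContinuityZ3.Theorems.FK

namespace MonotonicOSSS

open MeasureTheory Finset Function Filter Topology Set
open Literature.Probability.Percolation Literature.Probability.LatticeModels Literature.Barriers.CriticalPhenomena
open Literature.Probability.Percolation.DCT16

variable {d : ℕ} {q : ℝ}

/-- **THE MEAN-FIELD BOUND FOR THE FREE PERCOLATION PROBABILITY**: for `d ≥ 2`, `q ≥ 1` and `p₁ ∈ (p_c(q), 1)` there is `c > 0`
with `θ⁰(p,q) ≥ c (p − p_c(q))` for all `p ∈ (p_c(q), p₁]`. [cite: DuminilCopinRaoufiTassion2019, Thm 1.2 (2) (free boundary condition via θ¹(p') ≤ θ⁰(p), p' < p)] -/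
theorem exists_pos_forall_thetaFree_ge_mul_sub (hd : 2 ≤ d) (hq : 1 ≤ q) {p₁ : ℝ} (hpc : rcCriticalProb d q < p₁)
    (hp₁ : p₁ < 1) :
    ∃ c : ℝ, 0 < c ∧ ∀ p ∈ Set.Ioc (rcCriticalProb d q) p₁, c * (p - rcCriticalProb d q) ≤ thetaFree d p q := by
  obtain ⟨c, hc, h⟩ := exists_pos_forall_thetaWired_ge_mul_sub hd hq hpc hp₁
  have hpc0 : 0 < rcCriticalProb d q := rcCriticalProb_pos (by omega) hq
  refine ⟨c, hc, fun p hp => ?_⟩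
  have hpI : p ∈ Set.Icc (0 : ℝ) 1 := ⟨(hpc0.trans hp.1).le, hp.2.trans hp₁.le⟩
  -- for every `p' ∈ (p_c, p)`: `c (p' − p_c) ≤ θ¹(p') ≤ θ⁰(p)`; let `p' ↑ p`
  have key : ∀ p' : ℝ, rcCriticalProb d q < p' → p' < p → c * (p' - rcCriticalProb d q) ≤ thetaFree d p q := by
    intro p' h1 h2
    have hp'I : p' ∈ Set.Icc (0 : ℝ) 1 := ⟨(hpc0.trans h1).le, (h2.le.trans hpI.2)⟩
    exact (h p' ⟨h1, h2.le.trans hp.2⟩).trans (thetaWired_le_thetaFree_of_lt hq hp'I hpI h2)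
  by_contra hcon
  push Not at hcon
  -- pick `p'` with `c (p' − p_c) > θ⁰(p)`, i.e. `p' > θ⁰(p)/c + p_c`, and `p' < p`
  have h1 : thetaFree d p q / c + rcCriticalProb d q < p := by
    rw [div_add' _ _ _ hc.ne', div_lt_iff₀ hc]; linarith
  set p' : ℝ := (thetaFree d p q / c + rcCriticalProb d q + p) / 2 with hp'
  have h0 : 0 ≤ thetaFree d p q / c := div_nonneg (thetaFree_nonneg (d := d) p q) hc.le
  have hp'1 : rcCriticalProb d q < p' := by rw [hp']; linarith
  have hp'2 : p' < p := by rw [hp']; linarith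
  have h2 := key p' hp'1 hp'2
  have h3 : thetaFree d p q < c * (p' - rcCriticalProb d q) := by
    rw [hp']
    have : c * ((thetaFree d p q / c + rcCriticalProb d q + p) / 2 - rcCriticalProb d q)
        = (thetaFree d p q + c * (p - rcCriticalProb d q)) / 2 := by field_simp; ring
    rw [this]; linarith
  linarith

/-- **`q = 1` ON THE SQUARE LATTICE: `rcCriticalProb 2 1 = 1/2`** — Kesten's value by the random-cluster / decision-tree route
(with `rcCriticalProb_one_eq_criticalProb`, `p_c(ℤ²) = 1/2` for Bernoulli bond percolation; the tree's `kesten_criticalProb_Z2_holds`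
is the classical route). [cite: DuminilCopinRaoufiTassion2019, Thm 1.3 (q = 1)] -/
theorem rcCriticalProb_two_one : rcCriticalProb 2 1 = 1 / 2 := by
  rw [rcCriticalProb_two_eq le_rfl, Real.sqrt_one]; norm_num

/-- **Grimmett's Thm (6.30) conclusion (the hypothesis `h630` of MR-C) holds**: for `q ≥ 1` and every
`0 ≤ p < √(q−1)/(1+√(q−1))` (`= p_sd(q−1) ≤ p_sd(q) = p_c(q)`), the wired radius law decays exponentially on `ℤ²`.
[cite: Grimmett2006, Thm (6.30) (exponential decay of φ¹ below p_sd(q−1)), here from Thm 1.3 of DRT] -/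
theorem wired_exp_decay_below_selfDual_pred (hq : 1 ≤ q) (p : ℝ) (hp0 : 0 ≤ p)
    (hp : p < Real.sqrt (q - 1) / (1 + Real.sqrt (q - 1))) :
    ∃ α : ℝ, 0 < α ∧ ∀ m : ℕ, 1 ≤ m → (rcLimit 2 true p q).real (siteToBoundary 2 m) ≤ Real.exp (-(α * m)) := by
  have hs : Real.sqrt (q - 1) ≤ Real.sqrt q := Real.sqrt_le_sqrt (by linarith)
  have h1 : Real.sqrt (q - 1) / (1 + Real.sqrt (q - 1)) ≤ Real.sqrt q / (1 + Real.sqrt q) := by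
    have ha : 0 ≤ Real.sqrt (q - 1) := Real.sqrt_nonneg _
    have hb : 0 ≤ Real.sqrt q := Real.sqrt_nonneg _
    rw [div_le_div_iff₀ (by positivity) (by positivity)]
    nlinarith
  exact rcLimit_two_exp_decay_of_lt_selfDual hq true hp0 (hp.trans_le h1)

/-- **Grimmett's Thm (6.20) made unconditional** (and superseded by the exact value): for `q ≥ 2`,
`p_c(q) ≤ q/(q + √(q−1))` on `ℤ²`, MR-C's conditional bound with its hypothesis discharged.
[cite: Grimmett2006, Thm (6.20) (p_c(q) ≤ √q/(√(1−q⁻¹)+√q), q ≥ 2)] -/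
theorem rcCriticalProb_two_le_grimmett_620 (hq : 2 ≤ q) : rcCriticalProb 2 q ≤ q / (q + Real.sqrt (q - 1)) :=
  rcCriticalProb_le_of_wired_exp_decay_below_selfDual_pred hq (wired_exp_decay_below_selfDual_pred (one_le_two.trans hq))

end MonotonicOSSS

end Summit.CriticalPhenomena.PercolationContinuityZ3.Theorems.FK
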